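import Summits.CriticalPhenomena.CardyFormulaZ2.Theses.CardyBoundaryCoulombGas
import Literature.Probability.LatticeModels.RowStatePlanar
import Literature.Probability.Percolation.LatticeSymmetry
import Literature.Probability.Percolation.PlanarDuality
import Literature.Probability.Percolation.RSW

/-!
# Two-cluster dictionary, step lemma: one row step of the `⋆`-chain reads one column of bonds

Helper file for the stub `stub_twoClusterDictionary` (D3) of the line
`two-cluster-rate-is-stationary-gap` of crux `CardyBoundaryCoulombGas.StripClusterRates`
(stmt-CriticalPhenomena-13878).

The PATHWISE ROW DICTIONARY, inductive step (`d3_step`). Fix a lattice configuration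
`ω ⊆ E(ℤ²)`, a width `n` (column sites `S = {0,…,n}`), an old column `t` and the new column
`t' = t + 1 ≥ 0`. Suppose the connectivity state `π` of the `⋆`-chain ENCODES `ω`-connectivity of
the column `t` inside the old region `R_t = [0,t] × [0,n]` (two sites of column `t` are joined in `π`
iff they are equal or joined by an `ω`-open path inside `R_t`), with `⋆` joined to nothing. Drive one
row step `rowStep O H π` (`PercolationRowTransfer.lean`) with the bonds of `ω`: `O` = the open
horizontal lattice edges `{(t,y),(t',y)}` (the chain's "vertical" bonds), `H` = the open vertical lattice
edges `{(t',y),(t',y+1)}` of column `t'` (the chain's "horizontal" bonds). Then the new state encodes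
`ω`-connectivity of column `t'` inside `R_{t'} = [0,t'] × [0,n]`, and `⋆` is still joined to nothing.
With `t = -1` (empty old region, `π = free`) this is also the base case. Proof: `≤` by the universal
property of the join of equivalence relations (`horizRel H ρ = ρ ⊔ ⨆ hEdgeRel`); `≥` by induction on
an open lattice walk inside `R_{t'}`, cut at its visits to column `t'` (excursions into `R_t` start and
end with an open horizontal edge and are `π`-connections by hypothesis).

Sources: Bondesan–Jacobsen–Saleur, Nucl. Phys. B 867 (2013) §2 (connectivity transfer matrix);
Blöte–Nightingale 1982; folklore ("row-transfer exactness").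
-/

noncomputable section

namespace Summit.CriticalPhenomena.CardyFormulaZ2.Cruxes.StripClusterRates.TwoClusterRateIsStationaryGap

open Filter Topology
open scoped BigOperators Classical
open Literature.Probability.Percolation Literature.Probability.LatticeModels

/-- The site `(t, a)` of column `t ≥ 0`, `a ∈ {0,…,n}`, lies in the region `[0,t] × [0,n]`. -/
theorem d3_col_mem (n : ℕ) {t : ℤ} (ht : 0 ≤ t) (a : Finset.Icc (0 : ℤ) n) :
    (![t, (a : ℤ)] : Site 2) ∈ {u : Site 2 | 0 ≤ u 0 ∧ u 0 ≤ t ∧ 0 ≤ u 1 ∧ u 1 ≤ (n : ℤ)} := by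
  have ha := Finset.mem_Icc.1 a.2
  simp only [Set.mem_setOf_eq, Matrix.cons_val_zero, Matrix.cons_val_one, Matrix.cons_val_fin_one]
  omega

/-- **Row dictionary, one step.** If `π` encodes `ω`-connectivity of column `t` inside
`[0,t] × [0,n]` (`⋆` apart), then `rowStep O H π`, driven by the open horizontal edges `O` between the
columns `t`, `t' = t + 1` and the open vertical edges `H` of column `t'`, encodes `ω`-connectivity of
column `t'` inside `[0,t'] × [0,n]` (`⋆` apart). For `t = -1`, `π = free` this is the base case. -/
theorem d3_step (n : ℕ) (t t' : ℤ) (htt' : t' = t + 1) (ht' : 0 ≤ t') (ω : BondConfig (Site 2))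
    (hω : ω ⊆ (zdGraph 2).edgeSet) (π : RowState (Finset.Icc (0 : ℤ) n))
    (O H : Finset (Finset.Icc (0 : ℤ) n))
    (hO : ∀ y, y ∈ O ↔ s(![t, (y : ℤ)], ![t', (y : ℤ)]) ∈ ω)
    (hH : ∀ y, y ∈ H ↔ (y : ℤ) + 1 ≤ n ∧ s(![t', (y : ℤ)], ![t', (y : ℤ) + 1]) ∈ ω)
    (hπ : ∀ a b, π.rel (Sum.inl a) (Sum.inl b) ↔ a = b ∨
      ω ∈ openConnIn {u : Site 2 | 0 ≤ u 0 ∧ u 0 ≤ t ∧ 0 ≤ u 1 ∧ u 1 ≤ (n : ℤ)}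
        ![t, (a : ℤ)] ![t, (b : ℤ)])
    (hπs : ∀ a, ¬ π.JoinedToStar a) :
    (∀ a b, (rowStep O H π).rel (Sum.inl a) (Sum.inl b) ↔
      ω ∈ openConnIn {u : Site 2 | 0 ≤ u 0 ∧ u 0 ≤ t' ∧ 0 ≤ u 1 ∧ u 1 ≤ (n : ℤ)}
        ![t', (a : ℤ)] ![t', (b : ℤ)]) ∧
    ∀ a, ¬ (rowStep O H π).JoinedToStar a := by
  set R : Set (Site 2) := {u : Site 2 | 0 ≤ u 0 ∧ u 0 ≤ t ∧ 0 ≤ u 1 ∧ u 1 ≤ (n : ℤ)} with hR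
  set R' : Set (Site 2) := {u : Site 2 | 0 ≤ u 0 ∧ u 0 ≤ t' ∧ 0 ≤ u 1 ∧ u 1 ≤ (n : ℤ)} with hR'
  have hRR' : R ⊆ R' := fun u hu => ⟨hu.1, hu.2.1.trans (by omega), hu.2.2⟩
  have hcol : ∀ a : Finset.Icc (0 : ℤ) n, (![t', (a : ℤ)] : Site 2) ∈ R' := fun a =>
    d3_col_mem n ht' a
  -- `ω`-connectivity of column `t'` inside `R'`, an equivalence relation on the sites
  have conn_refl : ∀ a : Finset.Icc (0 : ℤ) n, ω ∈ openConnIn R' ![t', (a : ℤ)] ![t', (a : ℤ)] :=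
    fun a => openConnIn_refl (hcol a)
  have conn_symm : ∀ {a b : Finset.Icc (0 : ℤ) n}, ω ∈ openConnIn R' ![t', (a : ℤ)] ![t', (b : ℤ)] →
      ω ∈ openConnIn R' ![t', (b : ℤ)] ![t', (a : ℤ)] := fun h => by rwa [openConnIn_comm]
  -- (A) the new state is finer than "connected in `R'`" (with `⋆` alone)
  let ρ : Setoid (RowPoint (Finset.Icc (0 : ℤ) n)) :=
    { r := fun p q => p = q ∨ ∃ y y', p = Sum.inl y ∧ q = Sum.inl y' ∧
        ω ∈ openConnIn R' ![t', (y : ℤ)] ![t', (y' : ℤ)]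
      iseqv :=
        { refl := fun _ => Or.inl rfl
          symm := by
            rintro p q (rfl | ⟨y, y', rfl, rfl, h⟩)
            · exact Or.inl rfl
            · exact Or.inr ⟨y', y, rfl, rfl, conn_symm h⟩
          trans := by
            rintro p q r (rfl | ⟨y, y', rfl, rfl, h⟩) hqr
            · exact hqr
            · rcases hqr with rfl | ⟨z, z', hz, rfl, h'⟩
              · exact Or.inr ⟨y, y', rfl, rfl, h⟩
              · obtain rfl : y' = z := Sum.inl_injective hz
                exact Or.inr ⟨y, z', rfl, rfl, PlanarDuality.openConnIn_trans h h'⟩ } }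
  have hle : (rowStep O H π).rel ≤ ρ := by
    change horizRel H (vertRel O π.rel) ≤ ρ
    refine sup_le ?_ (Finset.sup_le fun x hx => ?_)
    · intro p q hpq
      rcases hpq with rfl | ⟨hp, hq, hpq⟩
      · exact Or.inl rfl
      rcases p with y | u <;> rcases q with y' | u'
      · rcases (hπ y y').1 hpq with rfl | hconn
        · exact Or.inl rfl
        · refine Or.inr ⟨y, y', rfl, rfl, ?_⟩
          have hy : s(![t, (y : ℤ)], ![t', (y : ℤ)]) ∈ ω := (hO y).1 hp
          have hy' : s(![t, (y' : ℤ)], ![t', (y' : ℤ)]) ∈ ω := (hO y').1 hq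
          have hyR : (![t, (y : ℤ)] : Site 2) ∈ R := hconn.1
          have hy'R : (![t, (y' : ℤ)] : Site 2) ∈ R := hconn.2.1
          have h1 : ω ∈ openConnIn R' ![t', (y : ℤ)] ![t, (y : ℤ)] :=
            openConnIn_of_adj (hcol y) (hRR' hyR) (by rw [Sym2.eq_swap]; exact hy) (by
              intro h; have := congr_fun h 0; simp at this; omega)
          have h2 : ω ∈ openConnIn R' ![t, (y : ℤ)] ![t, (y' : ℤ)] := openConnIn_mono hRR' _ _ hconn
          have h3 : ω ∈ openConnIn R' ![t, (y' : ℤ)] ![t', (y' : ℤ)] :=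
            openConnIn_of_adj (hRR' hy'R) (hcol y') hy' (by
              intro h; have := congr_fun h 0; simp at this; omega)
          exact PlanarDuality.openConnIn_trans (PlanarDuality.openConnIn_trans h1 h2) h3
      · exact absurd hpq (hπs y)
      · exact absurd (π.rel.symm' hpq) (hπs y')
      · exact Or.inl rfl
    · obtain ⟨hx1, hxω⟩ := (hH x).1 hx
      have hxS : (x : ℤ) + 1 ∈ Finset.Icc (0 : ℤ) n := by
        have := Finset.mem_Icc.1 x.2
        exact Finset.mem_Icc.2 ⟨by omega, hx1⟩
      rw [hEdgeRel_of_mem x hxS, joinTwo_le_iff]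
      refine Or.inr ⟨x, ⟨(x : ℤ) + 1, hxS⟩, rfl, rfl, ?_⟩
      exact openConnIn_of_adj (hcol x) (hcol ⟨(x : ℤ) + 1, hxS⟩) hxω (by
        intro h; have := congr_fun h 1; simp at this)
  have hA : ∀ a b, (rowStep O H π).rel (Sum.inl a) (Sum.inl b) →
      ω ∈ openConnIn R' ![t', (a : ℤ)] ![t', (b : ℤ)] := by
    intro a b h
    rcases hle h with h | ⟨y, y', hy, hy', h⟩
    · obtain rfl : a = b := Sum.inl_injective h
      exact conn_refl a
    · obtain rfl : a = y := Sum.inl_injective hy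
      obtain rfl : b = y' := Sum.inl_injective hy'
      exact h
  have hstar : ∀ a, ¬ (rowStep O H π).JoinedToStar a := by
    intro a h
    rcases hle h with h | ⟨y, y', -, hy', -⟩
    · exact Sum.inl_ne_inr h
    · exact Sum.inr_ne_inl hy'
  -- (B) "connected in `R'`" is finer than the new state: induction on an open lattice walk
  have hB : ∀ a b : Finset.Icc (0 : ℤ) n, ω ∈ openConnIn R' ![t', (a : ℤ)] ![t', (b : ℤ)] →
      (rowStep O H π).rel (Sum.inl a) (Sum.inl b) := by
    intro a b hab
    set σ : Setoid (RowPoint (Finset.Icc (0 : ℤ) n)) := (rowStep O H π).rel with hσ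
    have s1 : ∀ {p q}, vertRel O π.rel p q → σ p q := fun h => le_horizRel H _ h
    have s2 : ∀ (x : Finset.Icc (0 : ℤ) n) (hxS : (x : ℤ) + 1 ∈ Finset.Icc (0 : ℤ) n), x ∈ H →
        σ (Sum.inl x) (Sum.inl ⟨(x : ℤ) + 1, hxS⟩) := by
      intro x hxS hx
      have h1 : hEdgeRel x ≤ σ :=
        le_trans (Finset.le_sup (f := hEdgeRel) hx) (le_sup_right (a := vertRel O π.rel))
      exact h1 (hEdgeRel_rel x hxS)
    obtain ⟨P, hPs, hPe⟩ := exists_walk_of_mem_openConnIn hω hab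
    suffices key : ∀ (u v : Site 2) (P : (zdGraph 2).Walk u v), (∀ z ∈ P.support, z ∈ R') →
        (∀ e ∈ P.edges, e ∈ ω) → ∀ b : Finset.Icc (0 : ℤ) n, v 0 = t' → v 1 = (b : ℤ) →
          (∀ a : Finset.Icc (0 : ℤ) n, u 0 = t' → u 1 = (a : ℤ) → σ (Sum.inl a) (Sum.inl b)) ∧
          (u 0 ≤ t → ∃ c : Finset.Icc (0 : ℤ) n, c ∈ O ∧ ω ∈ openConnIn R u ![t, (c : ℤ)] ∧
            σ (Sum.inl c) (Sum.inl b)) by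
      exact (key _ _ P hPs hPe b (by simp) (by simp)).1 a (by simp) (by simp)
    intro u v P
    induction P with
    | nil =>
      intro hs he b hv0 hv1
      refine ⟨fun a hu0 hu1 => ?_, fun hu0 => ?_⟩
      · obtain rfl : a = b := Subtype.ext (hu1.symm.trans hv1)
        exact σ.refl _
      · exfalso; omega
    | @cons u w v hadj P ih =>
      intro hs he b hv0 hv1
      have huR' : u ∈ R' := hs u (by simp)
      have hwR' : w ∈ R' := hs w (by simp)
      have heω : s(u, w) ∈ ω := he _ (by simp)
      obtain ⟨ih1, ih2⟩ := ih (fun z hz => hs z (by simp [hz])) (fun e he' => he e (by simp [he']))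
        b hv0 hv1
      simp only [hR', Set.mem_setOf_eq] at huR' hwR'
      refine ⟨fun a hu0 hu1 => ?_, fun hu0 => ?_⟩
      · -- `u = (t', a)` lies on the new column
        have hueq : u = ![t', (a : ℤ)] := by
          rw [Site.eq_iff_two]; simp [hu0, hu1]
        rcases (zdGraph_two_adj_iff u w).1 hadj with ⟨h0, h1⟩ | ⟨h0, h1⟩ | ⟨h1, h0⟩ | ⟨h1, h0⟩
        · exfalso; omega
        · -- step to the left: an excursion into the old region
          have hw0 : w 0 ≤ t := by omega
          obtain ⟨c, hcO, hwc, hcb⟩ := ih2 hw0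
          have hweq : w = ![t, (a : ℤ)] := by
            rw [Site.eq_iff_two]; simp; omega
          have haO : a ∈ O := (hO a).2 (by rw [← hweq, ← hueq, Sym2.eq_swap]; exact heω)
          have hπac : π.rel (Sum.inl a) (Sum.inl c) :=
            (hπ a c).2 (Or.inr (by rw [← hweq]; exact hwc))
          have hv : vertRel O π.rel (Sum.inl a) (Sum.inl c) := Or.inr ⟨haO, hcO, hπac⟩
          exact σ.trans' (s1 hv) hcb
        · -- step up inside the new column
          have ha1 : (a : ℤ) + 1 ∈ Finset.Icc (0 : ℤ) n := by
            have := Finset.mem_Icc.1 a.2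
            rw [Finset.mem_Icc]; constructor <;> omega
          have hweq : w = ![t', (a : ℤ) + 1] := by
            rw [Site.eq_iff_two]; simp; omega
          have haH : a ∈ H := (hH a).2 ⟨by omega, by rw [← hueq, ← hweq]; exact heω⟩
          exact σ.trans' (s2 a ha1 haH) (ih1 ⟨(a : ℤ) + 1, ha1⟩ (by omega) (by simp; omega))
        · -- step down inside the new column
          have ha1 : (a : ℤ) - 1 ∈ Finset.Icc (0 : ℤ) n := by
            have := Finset.mem_Icc.1 a.2
            rw [Finset.mem_Icc]; constructor <;> omega
          have ha2 : (a : ℤ) - 1 + 1 ∈ Finset.Icc (0 : ℤ) n := by rw [sub_add_cancel]; exact a.2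
          have hweq : w = ![t', (a : ℤ) - 1] := by
            rw [Site.eq_iff_two]; simp; omega
          have haH : (⟨(a : ℤ) - 1, ha1⟩ : Finset.Icc (0 : ℤ) n) ∈ H := by
            refine (hH _).2 ⟨by simp; omega, ?_⟩
            simp only [sub_add_cancel]
            rw [← hueq, ← hweq, Sym2.eq_swap]; exact heω
          have h12 := s2 ⟨(a : ℤ) - 1, ha1⟩ ha2 haH
          have heq : (⟨((⟨(a : ℤ) - 1, ha1⟩ : Finset.Icc (0 : ℤ) n) : ℤ) + 1, ha2⟩ :
              Finset.Icc (0 : ℤ) n) = a := Subtype.ext (by simp)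
          rw [heq] at h12
          exact σ.trans' (σ.symm' h12) (ih1 ⟨(a : ℤ) - 1, ha1⟩ (by omega) (by simp; omega))
      · -- `u` lies in the old region
        by_cases hw0 : w 0 ≤ t
        · obtain ⟨c, hcO, hwc, hcb⟩ := ih2 hw0
          refine ⟨c, hcO, ?_, hcb⟩
          have huR : u ∈ R := ⟨huR'.1, hu0, huR'.2.2⟩
          have hwR : w ∈ R := ⟨hwR'.1, hw0, hwR'.2.2⟩
          exact PlanarDuality.openConnIn_trans (openConnIn_of_adj huR hwR heω hadj.ne) hwc
        · -- `w` on the new column: the step goes to the right, `u = (t, c)`, `w = (t', c)`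
          rcases (zdGraph_two_adj_iff u w).1 hadj with ⟨h0, h1⟩ | ⟨h0, h1⟩ | ⟨h1, h0⟩ | ⟨h1, h0⟩
          · have hc : u 1 ∈ Finset.Icc (0 : ℤ) n := Finset.mem_Icc.2 ⟨huR'.2.2.1, huR'.2.2.2⟩
            have hueq : u = ![t, u 1] := by
              rw [Site.eq_iff_two]; simp; omega
            have hweq : w = ![t', u 1] := by
              rw [Site.eq_iff_two]; simp; omega
            refine ⟨⟨u 1, hc⟩, (hO _).2 (by rw [← hueq, ← hweq]; exact heω), ?_,
              ih1 ⟨u 1, hc⟩ (by omega) (by simp [h1])⟩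
            rw [← hueq]
            exact openConnIn_refl ⟨huR'.1, hu0, huR'.2.2⟩
          · exfalso; omega
          · exfalso; omega
          · exfalso; omega
  exact ⟨fun a b => ⟨hA a b, hB a b⟩, hstar⟩


/-- Peeling the last step of an iteration over `List.ofFn` (time `0` first). -/
theorem d3_foldl_ofFn_succ {α β : Type*} (f : ℕ → α) (g : β → α → β) (b : β) (m : ℕ) :
    (List.ofFn fun i : Fin (m + 1) => f i).foldl g b =
      g ((List.ofFn fun i : Fin m => f i).foldl g b) (f m) := by
  rw [List.ofFn_succ', List.concat_eq_append, List.foldl_append]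
  simp

/-- **Row dictionary, iterated** (region in coordinates). Drive the `⋆`-chain from the FREE start
partitioned by the open vertical edges `H₀` of column `0`, with the bonds `seq t = (O_t, H_t)` read off
`ω` (`O_t` = open horizontal edges between columns `t`, `t+1`; `H_t` = open vertical edges of column
`t+1`). After `m` steps the state encodes `ω`-connectivity of column `m` inside `[0,m] × [0,n]`, and no
site is joined to `⋆`. -/
theorem d3_dictionary_aux (n : ℕ) (ω : BondConfig (Site 2)) (hω : ω ⊆ (zdGraph 2).edgeSet)
    (seq : ℕ → Finset (Finset.Icc (0 : ℤ) n) × Finset (Finset.Icc (0 : ℤ) n))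
    (hO : ∀ (t : ℕ) y, y ∈ (seq t).1 ↔ s(![(t : ℤ), (y : ℤ)], ![(t : ℤ) + 1, (y : ℤ)]) ∈ ω)
    (hH : ∀ (t : ℕ) y, y ∈ (seq t).2 ↔
      (y : ℤ) + 1 ≤ n ∧ s(![(t : ℤ) + 1, (y : ℤ)], ![(t : ℤ) + 1, (y : ℤ) + 1]) ∈ ω)
    (H₀ : Finset (Finset.Icc (0 : ℤ) n))
    (hH₀ : ∀ y, y ∈ H₀ ↔ (y : ℤ) + 1 ≤ n ∧ s(![0, (y : ℤ)], ![0, (y : ℤ) + 1]) ∈ ω) (m : ℕ) :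
    (∀ a b, ((List.ofFn fun i : Fin m => seq i).foldl (fun r OH => planarRowStep OH.1 OH.2 r)
        (planarRowStep Finset.univ H₀ ⟨RowState.free (Finset.Icc (0 : ℤ) n),
          RowState.isPlanar_free (Finset.Icc (0 : ℤ) n)⟩)).1.rel (Sum.inl a) (Sum.inl b) ↔
      ω ∈ openConnIn {u : Site 2 | 0 ≤ u 0 ∧ u 0 ≤ (m : ℤ) ∧ 0 ≤ u 1 ∧ u 1 ≤ (n : ℤ)}
        ![(m : ℤ), (a : ℤ)] ![(m : ℤ), (b : ℤ)]) ∧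
    ∀ a, ¬ ((List.ofFn fun i : Fin m => seq i).foldl (fun r OH => planarRowStep OH.1 OH.2 r)
        (planarRowStep Finset.univ H₀ ⟨RowState.free (Finset.Icc (0 : ℤ) n),
          RowState.isPlanar_free (Finset.Icc (0 : ℤ) n)⟩)).1.JoinedToStar a := by
  induction m with
  | zero =>
    simp only [List.ofFn_zero, List.foldl_nil, Nat.cast_zero]
    -- the free start does not see the (fictitious) horizontal edges from column `-1`
    set O₀ : Finset (Finset.Icc (0 : ℤ) n) :=
      Finset.univ.filter fun y => s(![(-1 : ℤ), (y : ℤ)], ![0, (y : ℤ)]) ∈ ω with hO₀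
    have hfree : rowStep Finset.univ H₀ (RowState.free (Finset.Icc (0 : ℤ) n)) =
        rowStep O₀ H₀ (RowState.free (Finset.Icc (0 : ℤ) n)) := by
      apply RowState.ext
      show horizRel H₀ (vertRel _ ⊥) = horizRel H₀ (vertRel _ ⊥)
      rw [le_bot_iff.1 (vertRel_le _ _), le_bot_iff.1 (vertRel_le _ _)]
    have key := d3_step n (-1) 0 (by norm_num) le_rfl ω hω (RowState.free _) O₀ H₀
      (fun y => by simp [hO₀]) (fun y => hH₀ y) (fun a b => ?_) (fun a h => Sum.inl_ne_inr h)
    · change (∀ a b, (rowStep Finset.univ H₀ (RowState.free _)).rel _ _ ↔ _) ∧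
        ∀ a, ¬ (rowStep Finset.univ H₀ (RowState.free _)).JoinedToStar a
      rw [hfree]
      exact key
    · change Sum.inl a = Sum.inl b ↔ _
      constructor
      · exact fun h => Or.inl (Sum.inl_injective h)
      · rintro (rfl | h)
        · rfl
        · have := h.1
          simp at this
  | succ m ih =>
    rw [d3_foldl_ofFn_succ]
    have key := d3_step n m ((m : ℤ) + 1) rfl (by positivity) ω hω _ (seq m).1 (seq m).2 (hO m)
      (hH m) (fun a b => (ih.1 a b).trans ⟨Or.inr, fun h => h.elim
        (fun h => h ▸ openConnIn_refl (d3_col_mem n (by positivity) a)) id⟩) ih.2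
    push_cast
    exact key

/-- **Row dictionary** for the free start partitioned by column `0`'s own open vertical edges:
after `m` steps driven by the bonds of `ω`, two sites `a`, `b` of the last column are joined iff
`(m,a)` and `(m,b)` are joined by an `ω`-open path inside the rectangle `[0,m] × [0,n]`; no site is
joined to `⋆`. -/
theorem d3_dictionary : ∀ (n : ℕ) (ω : BondConfig (Site 2)), ω ⊆ (zdGraph 2).edgeSet →
    ∀ (seq : ℕ → Finset (Finset.Icc (0 : ℤ) n) × Finset (Finset.Icc (0 : ℤ) n)),
    (∀ (t : ℕ) y, y ∈ (seq t).1 ↔ s(![(t : ℤ), (y : ℤ)], ![(t : ℤ) + 1, (y : ℤ)]) ∈ ω) →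
    (∀ (t : ℕ) y, y ∈ (seq t).2 ↔
      (y : ℤ) + 1 ≤ n ∧ s(![(t : ℤ) + 1, (y : ℤ)], ![(t : ℤ) + 1, (y : ℤ) + 1]) ∈ ω) →
    ∀ (H₀ : Finset (Finset.Icc (0 : ℤ) n)),
    (∀ y, y ∈ H₀ ↔ (y : ℤ) + 1 ≤ n ∧ s(![0, (y : ℤ)], ![0, (y : ℤ) + 1]) ∈ ω) → ∀ (m : ℕ),
    (∀ a b, ((List.ofFn fun i : Fin m => seq i).foldl (fun r OH => planarRowStep OH.1 OH.2 r)
        (planarRowStep Finset.univ H₀ ⟨RowState.free (Finset.Icc (0 : ℤ) n),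
          RowState.isPlanar_free (Finset.Icc (0 : ℤ) n)⟩)).1.rel (Sum.inl a) (Sum.inl b) ↔
      ω ∈ openConnIn (rectangle m n : Set (Site 2)) ![(m : ℤ), (a : ℤ)] ![(m : ℤ), (b : ℤ)]) ∧
    ∀ a, ¬ ((List.ofFn fun i : Fin m => seq i).foldl (fun r OH => planarRowStep OH.1 OH.2 r)
        (planarRowStep Finset.univ H₀ ⟨RowState.free (Finset.Icc (0 : ℤ) n),
          RowState.isPlanar_free (Finset.Icc (0 : ℤ) n)⟩)).1.JoinedToStar a := by
  intro n ω hω seq hO hH H₀ hH₀ m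
  have hR : {u : Site 2 | 0 ≤ u 0 ∧ u 0 ≤ (m : ℤ) ∧ 0 ≤ u 1 ∧ u 1 ≤ (n : ℤ)} =
      (rectangle m n : Set (Site 2)) := by
    ext u
    simp [mem_rectangle_iff]
  rw [← hR]
  exact d3_dictionary_aux n ω hω seq hO hH H₀ hH₀ m

end Summit.CriticalPhenomena.CardyFormulaZ2.Cruxes.StripClusterRates.TwoClusterRateIsStationaryGap
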